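import Literature.Analysis.FluidPDE.Tao2016AveragedNS.SplitCascadeZeroScaleTauOne
import Literature.Analysis.FluidPDE.TaoCascadeZeroScaleNextState
import HarnessLib

/-!
# The split Prop. 6.5, §6.7: the state bounds (6.139)–(6.144) at `τ₁` from the drain (port of `TaoCascadeZeroScaleNextState`)

T. Tao, *Finite time blowup for an averaged three-dimensional Navier–Stokes equation*,
J. Amer. Math. Soc. 29 (2016), 601–674 = arXiv:1402.0290v3, §6.7 (Prop. 6.17 and its proof).
HONEST FRAMING: statements about the SPLIT cascade model system; nothing here proves the split
Prop. 6.5 and nothing here concerns the true Navier–Stokes equations.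

Split counterpart of `TaoCascadeZeroScaleNextState.lean` over the split `Setting`
(`SplitCascadeZeroScaleCritical.lean`): theorems that (transitively) read a mode equation take the
window certificate `hw : AsymWindow ε₀ K ε C₁ n₀ W T ζ` (`SplitCascadeRescaledWindow.lean`), with
which every estimate keeps the tree's exact right-hand side; the `Y/F`-only definitions and the
hypothesis-free lemmas of the tree file are reused (`open TaoCascade.ZeroScale`); statements and
proofs are otherwise the tree's, by renaming.

## References

* T. Tao, J. Amer. Math. Soc. 29 (2016), 601–674 = arXiv:1402.0290v3, §6.7.
  [`Tao2016AveragedNS`]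
-/

noncomputable section

open Set MeasureTheory intervalIntegral Filter Topology

namespace Literature.Analysis.FluidPDE

namespace Tao2016AveragedNS

open TaoCascade hiding ExitTrichotomy
open TaoCascade.ZeroScale hiding Context Setting

namespace ZeroScale

/-! ## Two elementary inequalities -/

section NextStateSection

variable {ε₀ K ε C₁ C₂ C₃ C₄ C₅ : ℝ} {n₀ N : ℤ} {ηp : ℤ → ℝ} {βp : ℕ → ℝ} {τ : ℤ → ℝ} {Y : Fin 4 → ℤ → ℝ → ℝ} {W : Fin 3 → ℤ → ℝ → ℝ}
  {F : ℤ → ℝ → ℝ} {T ζ : ℝ}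


/-- `(K^{-1/2})² = K⁻¹`. [cite: Tao2016AveragedNS, §6.7] -/
theorem Setting.K_rpow_neg_half_sq (hs : Setting ε₀ K ε C₁ C₂ C₃ C₄ C₅ n₀ N ηp βp τ Y W F T ζ) :
    (K ^ (-(1 : ℝ) / 2)) ^ 2 = K⁻¹ := by
  rw [← Real.rpow_natCast, ← Real.rpow_mul hs.K_pos.le]
  norm_num
  exact Real.rpow_neg_one K

/-- `K · K^{-1/2} ≥ 10³` (i.e. `√K ≥ 10³`) in the regime. [cite: Tao2016AveragedNS, §6.7] -/
theorem Setting.K_mul_rpow_neg_half_ge (hs : Setting ε₀ K ε C₁ C₂ C₃ C₄ C₅ n₀ N ηp βp τ Y W F T ζ) :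
    (10 : ℝ) ^ 3 ≤ K * K ^ (-(1 : ℝ) / 2) := by
  have hr := hs.K_rpow_neg_half_pos
  have hr3 := hs.K_rpow_neg_half_le
  have hsq := hs.K_rpow_neg_half_sq
  have hK := hs.K_pos
  -- `K r · r = 1`
  have h1 : K * K ^ (-(1 : ℝ) / 2) * K ^ (-(1 : ℝ) / 2) = 1 := by
    rw [mul_assoc, ← pow_two, hsq, mul_inv_cancel₀ hK.ne']
  by_contra hcon
  push Not at hcon
  have : K * K ^ (-(1 : ℝ) / 2) * K ^ (-(1 : ℝ) / 2) < 10 ^ 3 * (1 / 10 ^ 3) :=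
    calc K * K ^ (-(1 : ℝ) / 2) * K ^ (-(1 : ℝ) / 2) < 10 ^ 3 * K ^ (-(1 : ℝ) / 2) :=
          mul_lt_mul_of_pos_right hcon hr
      _ ≤ 10 ^ 3 * (1 / 10 ^ 3) := mul_le_mul_of_nonneg_left hr3 (by norm_num)
  rw [h1] at this
  norm_num at this

/-- `τ₁ ∈ [1/100, T]` ((6.138)). [cite: Tao2016AveragedNS, §6.6 Prop. 6.15 (6.138)] -/
theorem Setting.τone_mem_Icc (hs : Setting ε₀ K ε C₁ C₂ C₃ C₄ C₅ n₀ N ηp βp τ Y W F T ζ)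
    (hex : ExitTrichotomy ε₀ K Y F T) : τone K ε Y T ∈ Icc (1 / 100 : ℝ) T := by
  have hb := hs.τone_bounds hex
  have htc := hs.half_le_tc hex
  exact ⟨by linarith [hb.1], hb.2.1⟩

/-- **(6.142) at `τ₁ = t_c + K^{-1/2}`: `c₀(τ₁) ≥ 2e^{K⁹}ε²`** (from (6.165):
`c₀(τ₁) ≥ ½K⁻¹⁰ε² e^{0.48K^{10}K^{-1/2}}` and `0.48K^{9.5} - K⁹ ≥ 0.479K^{9.5}`, `√K ≥ 10³`).
[cite: Tao2016AveragedNS, §6.7 (6.165), §6.6 (6.142)] -/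
theorem Setting.c_zero_τone_ge (hs : Setting ε₀ K ε C₁ C₂ C₃ C₄ C₅ n₀ N ηp βp τ Y W F T ζ)
    (hw : AsymWindow ε₀ K ε C₁ n₀ W T ζ)
    (hex : ExitTrichotomy ε₀ K Y F T) (hτ : τone K ε Y T = tc K ε Y T + K ^ (-(1 : ℝ) / 2)) :
    2 * Real.exp (K ^ 9) * ε ^ 2 ≤ Y 2 0 (τone K ε Y T) := by
  have hb := hs.τone_bounds hex
  have hlow := (hs.c_zero_rotor_lower hw) hex (t := τone K ε Y T) ⟨hb.1, le_rfl⟩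
  have hr := hs.K_rpow_neg_half_pos
  have hr3 := hs.K_rpow_neg_half_le
  have hsq := hs.K_rpow_neg_half_sq
  have hKr := hs.K_mul_rpow_neg_half_ge
  have hK := hs.K_pos
  have hK1 := hs.one_le_K
  have hε := hs.ε_pos
  set r : ℝ := K ^ (-(1 : ℝ) / 2) with hr_def
  have hdt : τone K ε Y T - tc K ε Y T = r := by rw [hτ]; ring
  rw [hdt] at hlow
  -- `K⁹ = K^{10} r²`
  have hK9 : K ^ 9 = K ^ 10 * r ^ 2 := by
    rw [hsq]; field_simp
  -- the exponent gap `K⁹ + log(4K^{10}) ≤ 0.48 K^{10} r`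
  have hgap : K ^ 9 + Real.log (4 * K ^ 10) ≤ 48 / 100 * K ^ 10 * r := by
    have hrr : K ^ 10 * r ^ 2 ≤ 1 / 1000 * K ^ 10 * r := by
      have := mul_le_mul_of_nonneg_left hr3 (by positivity : 0 ≤ K ^ 10 * r)
      have e1 : K ^ 10 * r ^ 2 = K ^ 10 * r * r := by ring
      rw [e1]; linarith [this]
    have hA : 479 / 1000 * K ^ 10 * r ≤ 48 / 100 * K ^ 10 * r - K ^ 9 := by
      rw [hK9]; linarith [hrr]
    have hx0 : 0 ≤ 479 / 1000 * K ^ 10 * r := by positivity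
    have hbig : 4 * K ^ 10 ≤ Real.exp (479 / 1000 * K ^ 10 * r) := by
      refine le_trans ?_ (sq_div_four_le_exp hx0)
      have h1 : (10 : ℝ) ^ 3 * K ^ 9 ≤ K ^ 10 * r := by
        have := mul_le_mul_of_nonneg_left hKr (by positivity : (0 : ℝ) ≤ K ^ 9)
        calc (10 : ℝ) ^ 3 * K ^ 9 = K ^ 9 * 10 ^ 3 := by ring
          _ ≤ K ^ 9 * (K * r) := this
          _ = K ^ 10 * r := by ring
      have h2 : ((10 : ℝ) ^ 3 * K ^ 9) ^ 2 ≤ (K ^ 10 * r) ^ 2 := pow_le_pow_left₀ (by positivity) h1 2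
      have h3 : K ^ 10 ≤ K ^ 18 := pow_le_pow_right₀ hK1 (by norm_num)
      have e2 : (479 / 1000 * K ^ 10 * r) ^ 2 / 4 = (479 / 1000) ^ 2 / 4 * (K ^ 10 * r) ^ 2 := by ring
      have e3 : ((10 : ℝ) ^ 3 * K ^ 9) ^ 2 = 10 ^ 6 * K ^ 18 := by ring
      rw [e2]; rw [e3] at h2
      linarith [h2, h3, pow_pos hK 10]
    have hlog := Real.log_le_log (by positivity) hbig
    rw [Real.log_exp] at hlog
    linarith
  -- conclude
  have hpos : (0 : ℝ) < 4 * K ^ 10 := by positivity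
  have hexp : 4 * K ^ 10 * Real.exp (K ^ 9) ≤ Real.exp (48 / 100 * K ^ 10 * r) := by
    have := Real.exp_le_exp.2 hgap
    rw [Real.exp_add, Real.exp_log hpos] at this
    linarith
  calc 2 * Real.exp (K ^ 9) * ε ^ 2
      = 4 * K ^ 10 * Real.exp (K ^ 9) * (1 / 2 * ((K ^ 10)⁻¹ * ε ^ 2)) := by field_simp; ring
    _ ≤ Real.exp (48 / 100 * K ^ 10 * r) * (1 / 2 * ((K ^ 10)⁻¹ * ε ^ 2)) :=
        mul_le_mul_of_nonneg_right hexp (by positivity)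
    _ ≤ Y 2 0 (τone K ε Y T) := hlow

/-- **(6.143) at `τ₁`: `c₀(τ₁) ≤ ½e^{K^{10}}ε²`** (from (6.167): `c₀ ≤ 2K⁻¹⁰ε²e^{4K^{10}K^{-1/2}}`).
[cite: Tao2016AveragedNS, §6.7 (6.167), §6.6 (6.143)] -/
theorem Setting.c_zero_τone_le (hs : Setting ε₀ K ε C₁ C₂ C₃ C₄ C₅ n₀ N ηp βp τ Y W F T ζ)
    (hw : AsymWindow ε₀ K ε C₁ n₀ W T ζ)
    (hex : ExitTrichotomy ε₀ K Y F T) :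
    Y 2 0 (τone K ε Y T) ≤ Real.exp (K ^ 10) / 2 * ε ^ 2 := by
  have hb := hs.τone_bounds hex
  have hup := ((hs.c_zero_rotor_upper hw) hex (t := τone K ε Y T) ⟨hb.1, le_rfl⟩).2
  have hr := hs.K_rpow_neg_half_pos
  have hr3 := hs.K_rpow_neg_half_le
  have hK := hs.K_pos
  have hK1 := hs.one_le_K
  have h1 : Real.exp (4 * K ^ 10 * K ^ (-(1 : ℝ) / 2)) ≤ Real.exp (K ^ 10) := by
    refine Real.exp_le_exp.2 ?_
    have := mul_le_mul_of_nonneg_left hr3 (by positivity : 0 ≤ 4 * K ^ 10)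
    linarith [this, pow_pos hK 10]
  have h2 : 2 * (K ^ 10)⁻¹ ≤ 1 / 2 := by
    have h10 : (4 : ℝ) ≤ K ^ 10 := by
      have := hs.K_large
      calc (4 : ℝ) ≤ 10 ^ 6 := by norm_num
        _ ≤ K := this
        _ ≤ K ^ 10 := le_self_pow₀ hK1 (by norm_num)
    rw [show 2 * (K ^ 10)⁻¹ = 2 / K ^ 10 by ring, div_le_iff₀ (by positivity)]
    linarith
  have hε2 : 0 ≤ ε ^ 2 := by positivity
  calc Y 2 0 (τone K ε Y T) ≤ Real.exp (4 * K ^ 10 * K ^ (-(1 : ℝ) / 2)) * (2 * ((K ^ 10)⁻¹ * ε ^ 2)) := hup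
    _ = Real.exp (4 * K ^ 10 * K ^ (-(1 : ℝ) / 2)) * (2 * (K ^ 10)⁻¹) * ε ^ 2 := by ring
    _ ≤ Real.exp (K ^ 10) * (1 / 2) * ε ^ 2 := by
        apply mul_le_mul_of_nonneg_right _ hε2
        exact mul_le_mul h1 h2 (by positivity) (Real.exp_pos _).le
    _ = Real.exp (K ^ 10) / 2 * ε ^ 2 := by ring

/-- Regime arithmetic: `K⁻⁸ ≤ ε₀/800` and `K⁻⁸ ≤ 10⁻⁶`. [cite: Tao2016AveragedNS, §6.7] -/
theorem Setting.inv_K8_le (hs : Setting ε₀ K ε C₁ C₂ C₃ C₄ C₅ n₀ N ηp βp τ Y W F T ζ) :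
    (K ^ 8)⁻¹ ≤ ε₀ / 800 ∧ (K ^ 8)⁻¹ ≤ 1 / 10 ^ 6 := by
  have hK := hs.K_pos
  have hK1 := hs.one_le_K
  have hK6 := hs.K_large
  have hKε₀ := hs.Kε₀
  constructor
  · rw [inv_eq_one_div, div_le_div_iff₀ (by positivity) (by norm_num)]
    have h7 : (1 : ℝ) ≤ K ^ 7 := one_le_pow₀ hK1
    have h8 : (10 : ℝ) ^ 6 * K ^ 7 ≤ ε₀ * K ^ 8 := by
      calc (10 : ℝ) ^ 6 * K ^ 7 ≤ K * ε₀ * K ^ 7 := mul_le_mul_of_nonneg_right hKε₀ (by positivity)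
        _ = ε₀ * K ^ 8 := by ring
    have h9 := mul_le_mul_of_nonneg_left h7 (by norm_num : (0 : ℝ) ≤ 10 ^ 6)
    linarith [h8, h9]
  · rw [show (1 : ℝ) / 10 ^ 6 = (10 ^ 6)⁻¹ by norm_num]
    apply inv_anti₀ (by norm_num)
    calc (10 : ℝ) ^ 6 ≤ K := hK6
      _ ≤ K ^ 8 := le_self_pow₀ hK1 (by norm_num)

/-- **`b₀(τ₁)², c₀(τ₁)²` and the Lemma 6.9 defect are `≤ K⁻²⁰/4` together** (from (6.180), (6.143),
`ε ≤ K^{-100}`, `ε e^{K^{10}} ≤ 1`, `C₅(1+ε₀)^{-n₀/2} ≤ ε⁴e^{-10K^{10}}`).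
[cite: Tao2016AveragedNS, §6.7 (6.180), (6.167); §6.1] -/
theorem Setting.sq_bc_τone_le (hs : Setting ε₀ K ε C₁ C₂ C₃ C₄ C₅ n₀ N ηp βp τ Y W F T ζ)
    (hw : AsymWindow ε₀ K ε C₁ n₀ W T ζ)
    (hex : ExitTrichotomy ε₀ K Y F T) :
    Y 1 0 (τone K ε Y T) ^ 2 + Y 2 0 (τone K ε Y T) ^ 2 + 2 * (C₅ * (1 + ε₀) ^ (-(n₀ : ℝ) / 2)) ≤
      (K ^ 20)⁻¹ / 4 := by
  set t₁ : ℝ := τone K ε Y T with ht₁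
  have hb := hs.τone_bounds hex
  have hK := hs.K_pos
  have hK1 := hs.one_le_K
  have hK6 := hs.K_large
  have hε := hs.ε_pos
  have hε₀ := hs.ε₀_pos
  have hb0 := (hs.b_zero_rotor hw) hex (t := t₁) ⟨hb.1, le_rfl⟩
  have hcle := (hs.c_zero_τone_le hw) hex
  have hcpos : 0 < Y 2 0 t₁ := ((hs.c_zero_rotor_pos hw) hex (t := t₁) ⟨hb.1, le_rfl⟩).2
  have hεK : ε ≤ (K ^ 100)⁻¹ := hs.ε_le_K100
  have hε1 : ε ≤ 1 := hs.toRegime.ε_le_one hε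
  have hεexp : ε * Real.exp (K ^ 10) ≤ 1 := by
    have h1 : Real.exp (K ^ 10) ≤ Real.exp (10 ^ 6 * K ^ 10) :=
      Real.exp_le_exp.2 (by nlinarith [pow_pos hK 10])
    calc ε * Real.exp (K ^ 10) ≤ ε * Real.exp (10 ^ 6 * K ^ 10) := mul_le_mul_of_nonneg_left h1 hε.le
      _ ≤ 1 := hs.ε_exp
  have hb2 : Y 1 0 t₁ ^ 2 ≤ 16 * ε ^ 2 := by
    have hb0pos : 0 ≤ Y 1 0 t₁ := by linarith [hb0.1, hε.le]
    have h1 : Y 1 0 t₁ * Y 1 0 t₁ ≤ Y 1 0 t₁ * (4 * ε) := mul_le_mul_of_nonneg_left hb0.2 hb0pos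
    have h2 : Y 1 0 t₁ * (4 * ε) ≤ 4 * ε * (4 * ε) := mul_le_mul_of_nonneg_right hb0.2 (by positivity)
    rw [sq, show 16 * ε ^ 2 = 4 * ε * (4 * ε) by ring]
    exact h1.trans h2
  have hc2 : Y 2 0 t₁ ^ 2 ≤ ε ^ 2 / 4 := by
    have h1 : Y 2 0 t₁ ≤ ε / 2 := by
      calc Y 2 0 t₁ ≤ Real.exp (K ^ 10) / 2 * ε ^ 2 := hcle
        _ = ε * Real.exp (K ^ 10) * ε / 2 := by ring
        _ ≤ 1 * ε / 2 := by
            apply div_le_div_of_nonneg_right _ (by norm_num)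
            exact mul_le_mul_of_nonneg_right hεexp hε.le
        _ = ε / 2 := by ring
    have h2 : Y 2 0 t₁ * Y 2 0 t₁ ≤ Y 2 0 t₁ * (ε / 2) := mul_le_mul_of_nonneg_left h1 hcpos.le
    have h3 : Y 2 0 t₁ * (ε / 2) ≤ ε / 2 * (ε / 2) := mul_le_mul_of_nonneg_right h1 (by positivity)
    rw [sq, show ε ^ 2 / 4 = ε / 2 * (ε / 2) by ring]
    exact h2.trans h3
  have hC₅ : C₅ * (1 + ε₀) ^ (-(n₀ : ℝ) / 2) ≤ ε ^ 2 := by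
    have h1 := hs.toRegime.C_late hε₀ hε hs.C₁_nn hs.C₂_nn hs.C₅_nn hs.C₅_nn
      (by linarith [hs.C₁_nn, hs.C₂_nn])
    have h3 : Real.exp (-10 * K ^ 10) ≤ 1 := Real.exp_le_one_iff.2 (by nlinarith [pow_pos hK 10])
    have h4 : ε ^ 4 ≤ ε ^ 2 := pow_le_pow_of_le_one hε.le hε1 (by norm_num)
    have h5 : ε ^ 4 * Real.exp (-10 * K ^ 10) ≤ ε ^ 4 * 1 := mul_le_mul_of_nonneg_left h3 (by positivity)
    linarith
  have hε2K : ε ^ 2 ≤ (K ^ 200)⁻¹ := by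
    have := pow_le_pow_left₀ hε.le hεK 2
    rw [inv_pow, ← pow_mul] at this
    norm_num at this
    exact this
  have h1 : 19 * (K ^ 200)⁻¹ ≤ (K ^ 20)⁻¹ / 4 := by
    rw [div_eq_mul_inv, ← one_div, ← one_div, show (1 : ℝ) / K ^ 20 * 4⁻¹ = 1 / (4 * K ^ 20) by ring]
    rw [show 19 * (1 / K ^ 200) = 19 / K ^ 200 by ring, div_le_div_iff₀ (by positivity) (by positivity)]
    have h76 : (76 : ℝ) ≤ K ^ 180 := by
      calc (76 : ℝ) ≤ 10 ^ 6 := by norm_num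
        _ ≤ K := hK6
        _ ≤ K ^ 180 := le_self_pow₀ hK1 (by norm_num)
    have h77 := mul_le_mul_of_nonneg_left h76 (pow_pos hK 20).le
    have e : K ^ 200 = K ^ 20 * K ^ 180 := by ring
    rw [e]; linarith [h77]
  have h0 : 0 ≤ (K ^ 200)⁻¹ := by positivity
  linarith [hb2, hc2, hC₅, hε2K, h1, h0]

/-- **(6.144) at `τ₁` from the drain**: if `a₀(τ₁)² + d₀(τ₁)² ≤ ½K⁻²⁰` then `Ẽ₀(τ₁) ≤ ½K⁻²⁰`
(Lemma 6.9 at scale `0` and `sq_bc_τone_le`). [cite: Tao2016AveragedNS, §6.7 (6.174), §6.6 (6.144)] -/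
theorem Setting.F_zero_τone_le (hs : Setting ε₀ K ε C₁ C₂ C₃ C₄ C₅ n₀ N ηp βp τ Y W F T ζ)
    (hw : AsymWindow ε₀ K ε C₁ n₀ W T ζ)
    (hex : ExitTrichotomy ε₀ K Y F T)
    (had : Y 0 0 (τone K ε Y T) ^ 2 + Y 3 0 (τone K ε Y T) ^ 2 ≤ (K ^ 20)⁻¹ / 2) :
    F 0 (τone K ε Y T) ≤ 1 / 2 * (K ^ 20)⁻¹ := by
  have hb := hs.τone_bounds hex
  have hmem : τone K ε Y T ∈ Icc 0 T := (hs.mem_rotor hex ⟨hb.1, le_rfl⟩).1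
  have h1 := hs.prim.zero (τone K ε Y T) hmem
  rw [Fin.sum_univ_four] at h1
  have h2 := (hs.sq_bc_τone_le hw) hex
  have hk : 0 ≤ (K ^ 20)⁻¹ := by have := hs.K_pos; positivity
  linarith

/-- **`a₁(τ₁)² = 1 + O(K⁻⁸)`** from (6.146) and the drain: if `a₀(τ₁)² + d₀(τ₁)² ≤ ½K⁻²⁰` then
`1 - 2K⁻⁸ ≤ a₁(τ₁)² ≤ 1 + K⁻⁸`. [cite: Tao2016AveragedNS, §6.7 (6.146), last paragraph] -/
theorem Setting.a_one_sq_τone (hs : Setting ε₀ K ε C₁ C₂ C₃ C₄ C₅ n₀ N ηp βp τ Y W F T ζ)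
    (hw : AsymWindow ε₀ K ε C₁ n₀ W T ζ)
    (hex : ExitTrichotomy ε₀ K Y F T)
    (had : Y 0 0 (τone K ε Y T) ^ 2 + Y 3 0 (τone K ε Y T) ^ 2 ≤ (K ^ 20)⁻¹ / 2) :
    1 - 2 * (K ^ 8)⁻¹ ≤ Y 0 1 (τone K ε Y T) ^ 2 ∧ Y 0 1 (τone K ε Y T) ^ 2 ≤ 1 + (K ^ 8)⁻¹ := by
  have hb := hs.τone_bounds hex
  have hmem : τone K ε Y T ∈ Icc 0 T := (hs.mem_rotor hex ⟨hb.1, le_rfl⟩).1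
  have hK := hs.K_pos
  have hK1 := hs.one_le_K
  have hS := abs_le.mp (hs.sumSq_bound hmem)
  simp only [sumSq] at hS
  have h2 := (hs.sq_bc_τone_le hw) hex
  have hC₅ : 0 ≤ C₅ * (1 + ε₀) ^ (-(n₀ : ℝ) / 2) := by
    have := hs.C₅_nn
    have hq : (0 : ℝ) < 1 + ε₀ := by linarith [hs.ε₀_pos]
    positivity
  have h20_8 : (K ^ 20)⁻¹ ≤ (K ^ 8)⁻¹ := by
    apply inv_anti₀ (by positivity)
    exact pow_le_pow_right₀ hK1 (by norm_num)
  constructor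
  · linarith [hS.1, had, h2, hC₅, h20_8]
  · linarith [hS.2, sq_nonneg (Y 0 0 (τone K ε Y T)), sq_nonneg (Y 1 0 (τone K ε Y T)),
      sq_nonneg (Y 2 0 (τone K ε Y T)), sq_nonneg (Y 3 0 (τone K ε Y T))]

/-- **The state bounds (6.139)–(6.144) at `τ₁` from the drain.** In the `Setting`, if
`τ₁ = t_c + K^{-1/2}` (Props. 6.16–6.17), `a₀(τ₁)² + d₀(τ₁)² ≤ ½K⁻²⁰` and `a₁(τ₁) > 0`
((6.185)–(6.188)), then `NextState ε₀ K ε Y F τ₁`: (6.139) from (6.146) and `K⁻⁸ ≤ ε₀/800`,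
`1 + ε₀/200 ≤ (1+ε₀)^{1/100}`; (6.140)–(6.141) from (6.180); (6.142)–(6.143) from
`c_zero_τone_ge/le`; (6.144) from Lemma 6.9 at scale `0`.
[cite: Tao2016AveragedNS, §6.6 Prop. 6.15 (6.139)–(6.144), §6.7 (last paragraph)] -/
theorem Setting.nextState_of_drain (hs : Setting ε₀ K ε C₁ C₂ C₃ C₄ C₅ n₀ N ηp βp τ Y W F T ζ)
    (hw : AsymWindow ε₀ K ε C₁ n₀ W T ζ)
    (hex : ExitTrichotomy ε₀ K Y F T) (hτ : τone K ε Y T = tc K ε Y T + K ^ (-(1 : ℝ) / 2))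
    (had : Y 0 0 (τone K ε Y T) ^ 2 + Y 3 0 (τone K ε Y T) ^ 2 ≤ (K ^ 20)⁻¹ / 2)
    (ha₁ : 0 < Y 0 1 (τone K ε Y T)) :
    NextState ε₀ K ε Y F (τone K ε Y T) := by
  have hb := hs.τone_bounds hex
  have hK := hs.K_pos
  have hε := hs.ε_pos
  have hb0 := (hs.b_zero_rotor hw) hex (t := τone K ε Y T) ⟨hb.1, le_rfl⟩
  have hsq := (hs.a_one_sq_τone hw) hex had
  have hK8 := hs.inv_K8_le
  have hx0 : 0 < (K ^ 8)⁻¹ := by positivity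
  have ha := hundredth_bounds hx0 hK8.1 hK8.2 hs.ε₀_pos hs.ε₀_lt ha₁ hsq.1 hsq.2
  exact ⟨ha.1, ha.2, by linarith [hb0.1, hε.le], by linarith [hb0.2, hε.le], (hs.c_zero_τone_ge hw) hex hτ,
    (hs.c_zero_τone_le hw) hex, (hs.F_zero_τone_le hw) hex had⟩

end NextStateSection

end ZeroScale

end Tao2016AveragedNS

end Literature.Analysis.FluidPDE
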